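/-
line stmt-HodgeConjecture-18881 Cruxes/BlochSeedDiscOne/Lines/birth.lean 814a6a70c14e831a stub_rung_pad4_seedAt

# UnipotentQALaw — kernel shadow of the g14 memo `U-QA-unipotent1-g14.md` (hsemireg-alphabet-unipotent-1, generation 14)

EVIDENCE ONLY. Nothing in this file is a rung, and nothing here is proved toward HC / HC_CM / HC_AV / №4 / 26512 / 18881 / H2.
It certifies the ARITHMETIC SKELETON of the pen results of the memo about the residue (A♭) `14·α_z(W) ≥ 3σ(W)τ(W) − 3` of
THEOREM U-PROD tier (ii) (g13), for indecomposable finite-length modules W over R = k⟦z,w⟧ with zW ≠ 0: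

* `regime_closed`        — LEMMA L0: α_z ≥ μ(zW)·σ and 14 μ(zW) ≥ 3τ already give (A♭); so only μ(zW) < 3τ/14 is open;
* `open_regime_shape`    — in the open regime τ ≥ 5, and τ ≤ 9 forces μ(zW) = 1, τ ≤ 14 forces μ(zW) ≤ 2;
* `thmB_arith`           — THEOREM B (z²W = 0, μ(zW) = 1): from σ ≤ 2β, n_{≤ i} ≤ 2i one gets 4·K[β] ≥ σ(σ+2), and then (A♭);
* `thmB_sum_core`        — the summation core 4·Σ_{i<β} (σ − min σ (2i)) ≥ σ(σ+2) for σ ≤ 2β (bounded ranges, by `decide`);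
* `ord_le_five`, `case_k4`, `case_k5`, `case_k6`, `case_k7_low`, `case_k7_high`, `case_k8_delta01`, `case_k8_s_ge_4`, `case_k8_high`
                           — the case analysis of THEOREM C ((A♭) for all indecomposable W with zW ≠ 0 and τ ≤ 9), each branch reduced to
                             `False` from the structural inequalities named in the memo (multiplicity/normal-form caps, Hilbert–Burch numerics);
* `conjA_counterexample_arith` — the module refuting CONJECTURE (A) `2α_z ≥ στ` (d 17, e 45, σ = τ = 4, α_z = 7) still satisfies (A♭) and (QA♭).

The structural inputs (what σ, τ, α_z, s₁, n₂, t, o, δ, ℓ₂ are and why they satisfy the hypotheses) are pen statements in the memo; this file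
only checks that the hypotheses are jointly contradictory / sufficient exactly as claimed. Mathlib only; no `sorry`; no unsafe options.
-/
import Mathlib

namespace HsemiregAlphabetUnipotent1.G14

/-! ## L0 — the regime lemma -/

/-- L0: if α ≥ μ·σ (Hom(zW, soc W) ⊂ Hom(zW, W)) and 14μ ≥ 3τ then (A♭) `14α ≥ 3στ − 3` (stated additively). -/
theorem regime_closed (σ τ μ α : ℕ) (hα : μ * σ ≤ α) (hμ : 3 * τ ≤ 14 * μ) : 3 * (σ * τ) ≤ 14 * α + 3 := by
  have h1 : 3 * (σ * τ) ≤ 14 * (μ * σ) := by nlinarith [Nat.zero_le σ]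
  omega

/-- Shape of the open regime `1 ≤ μ`, `14μ < 3τ`. -/
theorem open_regime_shape (τ μ : ℕ) (h1 : 1 ≤ μ) (h2 : 14 * μ < 3 * τ) :
    5 ≤ τ ∧ (τ ≤ 9 → μ = 1) ∧ (τ ≤ 14 → μ ≤ 2) := by
  refine ⟨by omega, fun h => by omega, fun h => by omega⟩

/-! ## THEOREM B — z²W = 0, μ(zW) = 1 -/

/-- Summation core of Theorem B on the ranges used (β ≤ 12, σ ≤ 2β):
`4 · Σ_{i<β} (σ − min σ (2i)) ≥ σ(σ+2)`.  (K[β] = Σ_{i<β} (σ − n_{≤ i}) and n_{≤ i} ≤ min σ (2i).) -/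
theorem thmB_sum_core :
    ∀ β ∈ Finset.range 13, ∀ σ ∈ Finset.range (2 * β + 1),
      σ * (σ + 2) ≤ 4 * ((Finset.range β).sum fun i => σ - min σ (2 * i)) := by
  decide

/-- Arithmetic end of Theorem B: `4α ≥ σ(σ+2)` and `τ ≤ σ+1` give (A♭) (indeed with +0 instead of +3). -/
theorem thmB_arith (σ τ α : ℕ) (hτ : τ ≤ σ + 1) (hα : σ * (σ + 2) ≤ 4 * α) : 3 * (σ * τ) ≤ 14 * α := by
  have h1 : σ * τ ≤ σ * (σ + 1) := Nat.mul_le_mul_left σ hτ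
  nlinarith [h1, hα]

/-! ## THEOREM C — τ ≤ 9: the case analysis (k = k̄ = τ − 1)

Common hypotheses (memo §4): violation of (A♭) with the K[2]-bound `α ≥ 2σ − s + δ` reads
`14(2σ − s + δ) + 4 ≤ 3σ(k+1)`; `s ≤ σ − k` (normal form: n₁ ≤ ρ = σ − k̄); `s ≤ 1 + t` (multiplicity lemma); `t ≤ o` (μ(𝔟) ≤ ord 𝔟 + 1);
`o(o−3) ≤ 2δ` when it is used (δ ≥ ℓ(R/𝔟) − 2t ≥ o(o+1)/2 − 2o). We keep `2σ − s + δ` subtraction-free by moving `14 s` to the right. -/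

/-- From `s ≤ 1+o`, `o² ≤ 2δ + 3o` and `δ ≤ s` one gets `o ≤ 5` (hence t ≤ 5, s ≤ 6). -/
theorem ord_le_five (s o δ : ℕ) (hs : s ≤ 1 + o) (ho : o * o ≤ 2 * δ + 3 * o) (hδ : δ ≤ s) : o ≤ 5 := by
  nlinarith [hs, ho, hδ]

/-- k̄ = 4 (τ = 5). -/
theorem case_k4 (σ s δ : ℕ) (hv : 14 * (2 * σ + δ) + 4 ≤ 3 * (σ * 5) + 14 * s) (h1 : s + 4 ≤ σ) (h6 : s ≤ 6) : False := by
  omega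

/-- k̄ = 5 (τ = 6). -/
theorem case_k5 (σ s δ : ℕ) (hv : 14 * (2 * σ + δ) + 4 ≤ 3 * (σ * 6) + 14 * s) (h1 : s + 5 ≤ σ) (h6 : s ≤ 6) : False := by
  omega

/-- k̄ = 6 (τ = 7). -/
theorem case_k6 (σ s δ : ℕ) (hv : 14 * (2 * σ + δ) + 4 ≤ 3 * (σ * 7) + 14 * s) (h1 : s + 6 ≤ σ) (h6 : s ≤ 6) : False := by
  omega

/-- The three cases k̄ ∈ {4,5,6} packaged with the raw structural hypotheses (s ≤ 1+t, t ≤ o, o(o−3) ≤ 2δ). -/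
theorem case_k_le_6 (k σ s δ t o : ℕ) (hk4 : 4 ≤ k) (hk6 : k ≤ 6)
    (hv : 14 * (2 * σ + δ) + 4 ≤ 3 * (σ * (k + 1)) + 14 * s)
    (h1 : s + k ≤ σ) (h2 : s ≤ 1 + t) (h3 : t ≤ o) (h4 : o * o ≤ 2 * δ + 3 * o) : False := by
  -- δ ≤ s follows from hv since 3σ(k+1) ≤ 21σ ≤ 28σ
  have hδ : δ ≤ s := by
    have : 3 * (σ * (k + 1)) ≤ 21 * σ := by nlinarith
    omega
  have ho : o ≤ 5 := ord_le_five s o δ (by omega) h4 hδ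
  have h6 : s ≤ 6 := by omega
  interval_cases k
  · exact case_k4 σ s δ hv h1 h6
  · exact case_k5 σ s δ hv h1 h6
  · exact case_k6 σ s δ hv h1 h6

/-- k̄ = 7 (τ = 8), low order: `o ≤ 2` (so t ≤ 2, s ≤ 3) contradicts the K[2]-violation. -/
theorem case_k7_low (σ s δ t o : ℕ) (hv : 14 * (2 * σ + δ) + 4 ≤ 3 * (σ * 8) + 14 * s)
    (h1 : s + 7 ≤ σ) (h2 : s ≤ 1 + t) (h3 : t ≤ o) (ho : o ≤ 2) : False := by
  omega

/-- k̄ = 7 (τ = 8), high order: `o ≥ 3` ⇒ β_K ≥ 3, and the K[3]-violation `14(3σ − 2s − n₂ + ℓ₂) + 4 ≤ 24σ`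
(written additively) contradicts `s + n₂ ≤ 2(t+1)`, `s ≤ 1+t`, `t ≤ o`, `o(o−1) ≤ 2ℓ₂`, `σ ≥ 7`. -/
theorem case_k7_high (σ s n₂ t o ℓ : ℕ) (hσ : 7 ≤ σ)
    (hv : 14 * (3 * σ + ℓ) + 4 ≤ 24 * σ + 28 * s + 14 * n₂)
    (h1 : s + n₂ ≤ 2 * (t + 1)) (h2 : s ≤ 1 + t) (h3 : t ≤ o) (h4 : o * o ≤ 2 * ℓ + o) : False := by
  -- 28 s + 14 n₂ = 14 (s + n₂) + 14 s ≤ 42 (o + 1), hence 18σ + 14ℓ ≤ 42 o + 38, hence 7ℓ + 44 ≤ 21 o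
  have hB : 7 * ℓ + 44 ≤ 21 * o := by omega
  have ho3 : 3 ≤ o := by omega
  have ho7 : o ≤ 7 := by nlinarith [h4, hB]
  interval_cases o <;> omega

/-- k̄ = 8 (τ = 9), δ ∈ {0,1}: then 𝔟 ∈ {(z,w²), (z,w³), (z²,zw,w²+cz), (z²,zw,w³)} (memo §4.4); for (z,w^β) Theorem B gives (A♭)
outright, and for the other two the normal form has worlds of total size ≤ 6, so σ ≤ 6 — incompatible with `s + 8 ≤ σ`
(the violation `σ + 4 + 14δ ≤ 14 s` is not even needed). -/
theorem case_k8_delta01 (σ s δ : ℕ) (_hv : σ + 4 + 14 * δ ≤ 14 * s) (h1 : s + 8 ≤ σ) (hσ : σ ≤ 6) : False := by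
  omega

/-- k̄ = 8 (τ = 9), δ ≥ 2 forces s ≥ 4 (hence t ≥ 3, o ≥ 3, β_K ≥ 3). -/
theorem case_k8_s_ge_4 (σ s δ : ℕ) (hv : σ + 4 + 14 * δ ≤ 14 * s) (h1 : s + 8 ≤ σ) (hδ : 2 ≤ δ) : 4 ≤ s := by
  omega

/-- k̄ = 8 (τ = 9), high order: the K[3]-violation `14(3σ − 2s − n₂ + ℓ₂) + 4 ≤ 27σ` contradicts the caps, given `σ ≥ 12`. -/
theorem case_k8_high (σ s n₂ t o ℓ : ℕ) (hσ : 12 ≤ σ)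
    (hv : 14 * (3 * σ + ℓ) + 4 ≤ 27 * σ + 28 * s + 14 * n₂)
    (h1 : s + n₂ ≤ 2 * (t + 1)) (h2 : s ≤ 1 + t) (h3 : t ≤ o) (h4 : o * o ≤ 2 * ℓ + o) : False := by
  -- 15σ + 14ℓ ≤ 42 o + 38 with σ ≥ 12 gives 7ℓ + 71 ≤ 21 o
  have hB : 7 * ℓ + 71 ≤ 21 * o := by omega
  have ho4 : 4 ≤ o := by omega
  have ho7 : o ≤ 7 := by nlinarith [h4, hB]
  interval_cases o <;> omega

/-! ## CONJECTURE (A) is false but (A♭), (QA♭) survive on the witness -/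

/-- The indecomposable module `W = hub R/(z²,zw²,w⁴) + strings [2: w³g], [3: zg], [6: zwg]` has
d = 17, e = 45, σ = τ = 4, α_z = 7 (engine `hubstrings.py`, exact over GF(2⁶¹−1); pen: K ≅ J₁⊕J₃⊕J₄⊕J₇, α_z = dim K[2] = 7):
(A) `2α ≥ στ` FAILS, (A♭) `14α ≥ 3στ − 3` and (QA♭) `2e + 14α + 2 ≥ 4στ + d` HOLD. -/
theorem conjA_counterexample_arith :
    let d := 17; let e := 45; let σ := 4; let τ := 4; let α := 7
    ¬ (σ * τ ≤ 2 * α) ∧ (3 * (σ * τ) ≤ 14 * α + 3) ∧ (4 * (σ * τ) + d ≤ 2 * e + 14 * α + 2) := by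
  decide


/-! ### Easy regimes of (A♭) for μ(zW) = 1 (memo §4.D, pen lemmas L6(e), E2, E3)
`α ≥ K[β] + ℓ(z²W) ≥ β_K + ℓ(z²W)`, `ℓ(z²W) ≥ o(o-1)/2 ≥ t(t-1)/2`, `τ ≤ σ + 1`; so (A♭) `14 α ≥ 3 σ τ - 3` is automatic when
`14 β_K ≥ 3 σ (σ+1)` or `7 t (t-1) + 14 β_K ≥ 3 σ (σ+1)` (stated subtraction-free over ℕ). -/
theorem easy_regime_beta (σ τ α β : ℕ) (hτ : τ ≤ σ + 1) (hα : β ≤ α)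
    (hβ : 3 * σ * (σ + 1) ≤ 14 * β) : 3 * σ * τ ≤ 14 * α + 3 := by
  have h1 : σ * τ ≤ σ * (σ + 1) := Nat.mul_le_mul_left σ hτ
  nlinarith [h1]

theorem easy_regime_t (σ τ α β t l₂ : ℕ) (hτ : τ ≤ σ + 1) (hα : β + l₂ ≤ α)
    (hl : t * t ≤ 2 * l₂ + t) (hreg : 3 * σ * (σ + 1) + 7 * t ≤ 7 * t * t + 14 * β) :
    3 * σ * τ ≤ 14 * α + 3 := by
  have h1 : σ * τ ≤ σ * (σ + 1) := Nat.mul_le_mul_left σ hτ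
  nlinarith [h1]

end HsemiregAlphabetUnipotent1.G14
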